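import Summits.ValiantsHypothesis.ValiantsHypothesis.Theorems.NcSkewCombTypedPermanent
import HarnessLib

/-!
# Parse trees of noncommutative circuits and the normal-form conversion: the objects

LLS18 = Lagarde–Limaye–Srinivasan 2018, §2 and §4. A PARSE TREE of a circuit (a parse formula:
keep one summand of every sum gate and both factors of every product gate; short-circuit the sums,
delete the labels) IS a `Shape`; we list every parse tree of a circuit together with the term
(coefficient • monomial) its parse formula computes (`circuitPts`), define the value of such a
list (`ptVal`) and its value FILTERED at a shape up to rotation (`ptValAt`, `rotSim`), the node
addresses of a shape (`nodes`) and the SLOT CONVERSION `nfConv rot T P` (block `j` = `2N`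
product slots then `N` sum slots, `N = 2|T| − 1`). Semantics in `NcParseTreeValues`,
`NcParseTreeNormalForm`; headlines in `NcParseTreePermanent`.
MODEL: PRINT rotUPT (LLS18 §4) for a circuit P in the tree's syntax := every PARSE TREE of P —
obtained by keeping one summand of every sum gate and both factors of every product gate, recorded
as (shape, coefficient•monomial) — has a shape that is a ROTATION (rotSim true) of one shape T;
PRINT UPT := every parse tree has shape T. Formalised for circuits whose product gates have fan-in
1 or 2 (copies and binary products; weighted sums of any fan-in; NO `const` operands — in print
constants live on the + wires only, LLS18 p. 7); product fan-in ≥ 3 (allowed in print, removed by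
LLS18 Lemma 8) is NOT covered (= option (c)); `nfConv rot T P` is GateRot-typed by T (GateTyped for
rot = false) UNCONDITIONALLY and computes the sum of those parse trees of P whose shape is ∼ T —
hence P.ncEval itself exactly when P is print-rotUPT of class [[T]]; size 3(2|T|−1)(P.size+1). The
transfers' constants (LID_r: 2^((r+1)/3) ≤ 96·r·r·(s+1); PERM_(4r): same; print-UPT: 2^(r+1) ≤
24·r·(s+1)) are WEAKER than lidPoly_rot / ncPerPoly_rot / ncPerPoly_upt — the content is the
factorisation print-rotUPT → rot-NF → lidPoly_rot. NOT a new lower bound; 0 S-currency; closes NO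
item; A_nc stmt-23446 / PerNotNcVP / VP ≠ VNP untouched.
NON-VACUOUS / DEGENERATE: `nodes .leaf = [[]]`; a circuit with no gates converts to one block for
its output; an out-of-range output reference reads the ncEval junk `0` on both sides.
[cite: LagardeLimayeSrinivasan2018, §2, §3 Proposition 7, §4]
[cite: LimayeMalodSrinivasan2016, §7] [cite: ArvindRaja2016, §5]
-/

noncomputable section

namespace Summit.ValiantsHypothesis.ValiantsHypothesis.Theorems.NcParseTrees

set_option linter.dupNamespace false
open Literature.Computability.AlgebraicComplexity
  Literature.Computability.AlgebraicComplexity.ArithCircuit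
  Summit.ValiantsHypothesis.ValiantsHypothesis.Theorems.NcAutomatonIntersection
  Summit.ValiantsHypothesis.ValiantsHypothesis.Theorems.NcUniqueParseTree
  Summit.ValiantsHypothesis.ValiantsHypothesis.Theorems.NcRotParseTree
  Summit.ValiantsHypothesis.ValiantsHypothesis.Theorems.NcSkewCombTypedPermanent

universe u v

/-! ### §1 Rotation-similarity of shapes

A PARSE TREE of a circuit (LLS18 §2: a parse formula with its + gates short-circuited and all
labels deleted) IS a `Shape`; we carry each parse tree together with the term
(coefficient • monomial) its parse formula computes: an entry `(S, t) : Shape × FreeAlgebra R σ`. -/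

/-- ROTATION-SIMILARITY of shapes (`rot = true`: `T₁ ∼ T₂`, obtained by reordering the children
of nodes, LLS18 §4; `rot = false`: equality). [cite: LagardeLimayeSrinivasan2018, §4] -/
def rotSim (rot : Bool) : Shape → Shape → Bool
  | .leaf, .leaf => true
  | .leaf, .node _ _ => false
  | .node _ _, .leaf => false
  | .node a b, .node c d =>
    (rotSim rot a c && rotSim rot b d) || (rot && (rotSim rot a d && rotSim rot b c))

variable {R : Type u} [CommSemiring R] {σ : Type v}

/-- `∼` is reflexive. [cite: LagardeLimayeSrinivasan2018, §4] -/
theorem sim_refl (rot : Bool) (A : Shape) : rotSim rot A A = true := by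
  induction A with
  | leaf => rfl
  | node a b iha ihb => simp [rotSim, iha, ihb]

/-- `∼` is symmetric. [cite: LagardeLimayeSrinivasan2018, §4] -/
theorem sim_symm (rot : Bool) (A B : Shape) : rotSim rot A B = rotSim rot B A := by
  induction A generalizing B with
  | leaf => cases B <;> rfl
  | node a b iha ihb =>
    cases B with
    | leaf => rfl
    | node c d =>
      simp only [rotSim, iha, ihb]
      rw [Bool.and_comm (rotSim rot d a) (rotSim rot c b)]

/-- `∼` is transitive (LLS18 §4: an equivalence relation).
[cite: LagardeLimayeSrinivasan2018, §4] -/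
theorem sim_trans (rot : Bool) {A B C : Shape} (h₁ : rotSim rot A B = true)
    (h₂ : rotSim rot B C = true) : rotSim rot A C = true := by
  induction A generalizing B C with
  | leaf =>
    cases B with
    | leaf => exact h₂
    | node _ _ => exact absurd h₁ (by simp [rotSim])
  | node a b iha ihb =>
    cases B with
    | leaf => exact absurd h₁ (by simp [rotSim])
    | node c d =>
      cases C with
      | leaf => exact absurd h₂ (by simp [rotSim])
      | node e f =>
        simp only [rotSim, Bool.or_eq_true, Bool.and_eq_true] at h₁ h₂ ⊢
        rcases h₁ with ⟨h1, h2⟩ | ⟨hr, h1, h2⟩ <;> rcases h₂ with ⟨h3, h4⟩ | ⟨hr', h3, h4⟩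
        · exact Or.inl ⟨iha h1 h3, ihb h2 h4⟩
        · exact Or.inr ⟨hr', iha h1 h3, ihb h2 h4⟩
        · exact Or.inr ⟨hr, iha h1 h4, ihb h2 h3⟩
        · exact Or.inl ⟨iha h1 h4, ihb h2 h3⟩

/-- Without rotations similarity is equality. [cite: LagardeLimayeSrinivasan2018, §2] -/
theorem sim_false_iff (A B : Shape) : rotSim false A B = true ↔ A = B := by
  induction A generalizing B with
  | leaf => cases B <;> simp [rotSim]
  | node a b iha ihb =>
    cases B with
    | leaf => simp [rotSim]
    | node c d => simp [rotSim, iha, ihb]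

/-! ### §2 The parse trees of a circuit (LLS18 §2: `T(C)`, each tree with its term) -/

/-- Parse trees (with their terms) of an OPERAND, given the lists `W` of those of the earlier
gates: a letter is one leaf, a constant has none (print: no constants at input gates), a gate
reference copies (junk `[]` out of range). [cite: LagardeLimayeSrinivasan2018, §2] -/
def opPts (W : List (List (Shape × FreeAlgebra R σ))) :
    Operand R σ → List (Shape × FreeAlgebra R σ)
  | .var x => [(.leaf, FreeAlgebra.ι R x)]
  | .const _ => []
  | .gate j => W.getD j []

/-- Parse trees of a weighted sum: the weighted concatenation.
[cite: LagardeLimayeSrinivasan2018, §2] -/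
def sumPts (W : List (List (Shape × FreeAlgebra R σ))) :
    List (R × Operand R σ) → List (Shape × FreeAlgebra R σ)
  | [] => []
  | a :: rest => (opPts W a.2).map (fun e => (e.1, a.1 • e.2)) ++ sumPts W rest

/-- Parse trees of an ordered binary product: all pairs, shapes joined at a new root.
[cite: LagardeLimayeSrinivasan2018, §2] -/
def pairPts : List (Shape × FreeAlgebra R σ) → List (Shape × FreeAlgebra R σ) →
    List (Shape × FreeAlgebra R σ)
  | [], _ => []
  | e :: L, M => M.map (fun f => (Shape.node e.1 f.1, e.2 * f.2)) ++ pairPts L M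

/-- Parse trees of a GATE (products of fan-in ≥ 3 or 0 are outside the binary model: none).
[cite: LagardeLimayeSrinivasan2018, §2] -/
def gatePts (W : List (List (Shape × FreeAlgebra R σ))) :
    Gate R σ → List (Shape × FreeAlgebra R σ)
  | .sum args => sumPts W args
  | .prod [u] => opPts W u
  | .prod [u, u'] => pairPts (opPts W u) (opPts W u')
  | .prod _ => []

/-- The lists of parse trees of a gate list (left fold, as `ncGateValues`).
[cite: LagardeLimayeSrinivasan2018, §2] -/
def ptLists (gs : List (Gate R σ)) : List (List (Shape × FreeAlgebra R σ)) :=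
  gs.foldl (fun W g => W ++ [gatePts W g]) []

/-- `T(C)`: the parse trees of a circuit, each with its term.
[cite: LagardeLimayeSrinivasan2018, §2] -/
def circuitPts (P : ArithCircuit R σ) : List (Shape × FreeAlgebra R σ) :=
  opPts (ptLists P.gates) P.output

/-- The value of a parse-tree list: the sum of its terms. [cite: LagardeLimayeSrinivasan2018, §2] -/
def ptVal (L : List (Shape × FreeAlgebra R σ)) : FreeAlgebra R σ :=
  (L.map Prod.snd).sum

/-- The value of a parse-tree list FILTERED at a shape `S` (up to rotation if `rot`).
[cite: LagardeLimayeSrinivasan2018, §4] -/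
def ptValAt (rot : Bool) (S : Shape) (L : List (Shape × FreeAlgebra R σ)) : FreeAlgebra R σ :=
  (L.map fun e => if rotSim rot e.1 S = true then e.2 else 0).sum

/-- One step of the fold. [cite: LagardeLimayeSrinivasan2018, §2] -/
theorem ptLists_append_singleton (gs : List (Gate R σ)) (g : Gate R σ) :
    ptLists (gs ++ [g]) = ptLists gs ++ [gatePts (ptLists gs) g] := by
  simp [ptLists, List.foldl_append]

/-- One list per gate. [cite: LagardeLimayeSrinivasan2018, §2] -/
theorem length_ptLists (gs : List (Gate R σ)) : (ptLists gs).length = gs.length := by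
  induction gs using List.reverseRecOn with
  | nil => rfl
  | append_singleton gs g ih =>
    rw [ptLists_append_singleton, List.length_append, List.length_append, ih]; rfl

/-- Appending gates keeps the earlier parse-tree lists. [cite: LagardeLimayeSrinivasan2018, §2] -/
theorem ptLists_getD_append (gs t : List (Gate R σ)) {j : ℕ} (hj : j < gs.length) :
    (ptLists (gs ++ t)).getD j [] = (ptLists gs).getD j [] := by
  induction t using List.reverseRecOn with
  | nil => rw [List.append_nil]
  | append_singleton t g ih =>
    rw [← List.append_assoc, ptLists_append_singleton,
      List.getD_append _ _ _ _ (by rw [length_ptLists, List.length_append]; omega), ih]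

/-! ### §3 Node addresses of a shape -/

/-- The node addresses of a shape, root first. [cite: LagardeLimayeSrinivasan2018, §2] -/
def nodes : Shape → List (List Bool)
  | .leaf => [[]]
  | .node l r => [] :: ((nodes l).map (List.cons false) ++ (nodes r).map (List.cons true))

/-- Address `0` is the root. [cite: LagardeLimayeSrinivasan2018, §2] -/
theorem nodes_getD_zero (T : Shape) : (nodes T).getD 0 [] = [] := by
  cases T <;> rfl

/-- `|nodes T| = 2|T| − 1`. [cite: LagardeLimayeSrinivasan2018, §2] -/
theorem length_nodes (T : Shape) : (nodes T).length = 2 * T.size - 1 ∧ 1 ≤ T.size := by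
  induction T with
  | leaf => exact ⟨rfl, le_rfl⟩
  | node l r ihl ihr =>
    obtain ⟨h1, h2⟩ := ihl
    obtain ⟨h3, h4⟩ := ihr
    simp only [nodes, List.length_cons, List.length_append, List.length_map, Shape.size]
    constructor <;> omega

/-- Addresses are exactly the paths into the tree. [cite: LagardeLimayeSrinivasan2018, §2] -/
theorem mem_nodes_iff {T : Shape} {π : List Bool} :
    π ∈ nodes T ↔ ∃ S, T.sub π = some S := by
  induction T generalizing π with
  | leaf =>
    cases π with
    | nil => simp [nodes, Shape.sub_nil]
    | cons c π => simp [nodes, Shape.sub]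
  | node l r ihl ihr =>
    cases π with
    | nil => simp [nodes, Shape.sub_nil]
    | cons c π => cases c <;> simp [nodes, Shape.sub, ihl, ihr]

/-! ### §4 The conversion: block `j` = `2N` product slots then `N` sum slots (`N = |nodes T|`) -/

/-- Index of the SUM slot of block `j'` at node number `i`.
[cite: LagardeLimayeSrinivasan2018, §3] -/
def sref (N j' i : ℕ) : ℕ := 3 * N * j' + 2 * N + i

/-- Conversion of an operand of gate `j` at node address `π`: a letter stays iff `π` is a leaf,
constants and non-earlier references become `0`, a reference to gate `j' < j` becomes the
reference to the sum slot `(j', π)`. [cite: LagardeLimayeSrinivasan2018, §3 Proposition 7] -/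
def opConv (T : Shape) (j : ℕ) (π : List Bool) : Operand R σ → Operand R σ
  | .var x =>
    match T.sub π with
    | some .leaf => .var x
    | _ => .const 0
  | .const _ => .const 0
  | .gate j' => if j' < j then .gate (sref (nodes T).length j' ((nodes T).idxOf π)) else .const 0

/-- PRODUCT slot `(i, b)` of block `j`: at an internal node `π_i = (l, r)`, `b = 0` is the
straight product `u@π_i0 · u'@π_i1`, `b = 1` the ROTATED one `u@π_i1 · u'@π_i0` — present only
with rotations and only if `l ≁ r`; everything else is the empty sum.
[cite: LagardeLimayeSrinivasan2018, §4] -/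
def pslot (rot : Bool) (T : Shape) (j i b : ℕ) : Gate R σ → Gate R σ
  | .prod [u, u'] =>
    match T.sub ((nodes T).getD i []) with
    | some (.node l r) =>
      if b = 0 then
        .prod [opConv T j ((nodes T).getD i [] ++ [false]) u,
          opConv T j ((nodes T).getD i [] ++ [true]) u']
      else if (rot && !(rotSim rot l r)) = true then
        .prod [opConv T j ((nodes T).getD i [] ++ [true]) u,
          opConv T j ((nodes T).getD i [] ++ [false]) u']
      else .sum []
    | _ => .sum []
  | _ => .sum []

/-- SUM slot `i` of block `j`: the converted sum / copy, or (binary product) the sum of the two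
product slots `(i, 0)`, `(i, 1)` of the same block.
[cite: LagardeLimayeSrinivasan2018, §3 Proposition 7] -/
def sslot (T : Shape) (j i : ℕ) : Gate R σ → Gate R σ
  | .sum args => .sum (args.map fun a => (a.1, opConv T j ((nodes T).getD i []) a.2))
  | .prod [u] => .sum [(1, opConv T j ((nodes T).getD i []) u)]
  | .prod [_, _] =>
    .sum [(1, .gate (3 * (nodes T).length * j + 2 * i)),
      (1, .gate (3 * (nodes T).length * j + 2 * i + 1))]
  | .prod _ => .sum []

/-- The product slots of block `j`. [cite: LagardeLimayeSrinivasan2018, §3 Proposition 7] -/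
def prodPart (rot : Bool) (T : Shape) (j : ℕ) (g : Gate R σ) : List (Gate R σ) :=
  (List.range (2 * (nodes T).length)).map fun q => pslot rot T j (q / 2) (q % 2) g

/-- The sum slots of block `j`. [cite: LagardeLimayeSrinivasan2018, §3 Proposition 7] -/
def sumPart (T : Shape) (j : ℕ) (g : Gate R σ) : List (Gate R σ) :=
  (List.range (nodes T).length).map fun i => sslot T j i g

/-- The blocks of a gate list, numbered from `j`.
[cite: LagardeLimayeSrinivasan2018, §3 Proposition 7] -/
def nfBlocks (rot : Bool) (T : Shape) : ℕ → List (Gate R σ) → List (Gate R σ)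
  | _, [] => []
  | j, g :: gs => (prodPart rot T j g ++ sumPart T j g) ++ nfBlocks rot T (j + 1) gs

/-- The (3N-periodic) typing of the slots. [cite: LagardeLimayeSrinivasan2018, §3 Proposition 7] -/
def nfTy (T : Shape) (m : ℕ) : List Bool :=
  if m % (3 * (nodes T).length) < 2 * (nodes T).length then
    (nodes T).getD (m % (3 * (nodes T).length) / 2) []
  else (nodes T).getD (m % (3 * (nodes T).length) - 2 * (nodes T).length) []

/-- THE NORMAL-FORM CONVERSION of `P` along the shape `T`: the blocks of
`P.gates ++ [copy of the output]`, output = the root sum slot of that copy.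
[cite: LagardeLimayeSrinivasan2018, §3 Proposition 7] -/
def nfConv (rot : Bool) (T : Shape) (P : ArithCircuit R σ) : ArithCircuit R σ where
  gates := nfBlocks rot T 0 (P.gates ++ [Gate.prod [P.output]])
  output := .gate (3 * (nodes T).length * P.gates.length + 2 * (nodes T).length)

/-- `3N` slots per gate. [cite: LagardeLimayeSrinivasan2018, §3 Proposition 7] -/
theorem length_nfBlocks (rot : Bool) (T : Shape) (gs : List (Gate R σ)) (j : ℕ) :
    (nfBlocks rot T j gs).length = 3 * (nodes T).length * gs.length := by
  induction gs generalizing j with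
  | nil => simp [nfBlocks]
  | cons g gs ih =>
    simp only [nfBlocks, List.length_append, ih, List.length_cons, prodPart, sumPart,
      List.length_map, List.length_range]
    ring

/-- One more gate, one more block. [cite: LagardeLimayeSrinivasan2018, §3 Proposition 7] -/
theorem nfBlocks_append (rot : Bool) (T : Shape) (gs : List (Gate R σ)) (g : Gate R σ) (j : ℕ) :
    nfBlocks rot T j (gs ++ [g]) =
      nfBlocks rot T j gs ++ (prodPart rot T (j + gs.length) g ++ sumPart T (j + gs.length) g) := by
  induction gs generalizing j with
  | nil => simp [nfBlocks]
  | cons g' gs ih =>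
    simp only [List.cons_append, nfBlocks, ih, List.length_cons, List.append_assoc,
      show j + 1 + gs.length = j + (gs.length + 1) by omega]

end Summit.ValiantsHypothesis.ValiantsHypothesis.Theorems.NcParseTrees

end
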